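import Mathlib
import Literature.NumberTheory.Sieve.GeometricGridDecomposition
import Summits.Parity.BatemanHorn.Theorems.PolynomialMobiusPolyMobiusTailStubPairMiddleBoxes2

/-!
# Crux `PolyMobiusTail` (stmt-Parity-0870), line `eta-free-multilinear-window`, stub `stub_pair_middle`
# — helper 2: grids and the per-box bound

* `disp_terms_le` — the four terms of the per-box dispersion bound (`stub_pair_middle_boxdisp`) are uniformly
  `≤ 3L⁴x^{1−ν} + 4κx/L^{Ad} + (4√(2q₁)+1)x^{1−ν}` on the boxes of the fine grid;
* `grid_facts` — the two geometric grids (in `d₀` and in `m`) with their step counts and ratio facts;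
* `perbox_bound` — TRUE box sum ≤ shells (`stub_pair_middle_box_reduction2`) + `K ·` uniform dispersion bound.
Head: the registered auxiliary stub `stub_pair_middle_perbox`.
-/

open scoped BigOperators
open Finset Real Filter Polynomial Asymptotics

namespace Summit.Parity.BatemanHorn.Theorems.PolyMobiusTail.EtaFreeWindow

namespace MiddleAssembly

open Literature.NumberTheory.Sieve Literature.NumberTheory.Sieve.GeometricGrid


/-- `√(ab) = √a √b` and monotonicity facts are used via `Real.sqrt`; we phrase `t ^ (1/2)` as `√t`. -/
theorem rpow_half_eq_sqrt (t : ℝ) : t ^ (1 / 2 : ℝ) = Real.sqrt t := by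
  rw [Real.sqrt_eq_rpow]

/-- **Uniform per-box bound for the dispersion terms.**  With `L ≥ 1`, `0 < κ ≤ 1`, `x ≥ 1`,
`0 < M₀r ≤ Mb'`, `Mb' − Mb + 1 ≤ 4 κ Mb'`, `x^{σ₁/2} ≤ 2 M₀r`, `Mb' ≤ 2 q x^{σ₂+η}`, `0 < P' ≤ x^{σ₂}`
and the exponent bookkeeping `ν ≤ σ₁/4`, `ν ≤ δ ≤ 1/16`, `η ≤ 1/16`, `σ₂ < 1/2`,
`δ + (1+θ)/2 + σ₂ ≤ 1 − ν`, the four terms of `stub_pair_middle_boxdisp` are at most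
`3 L⁴ x^{1−ν} + 4κ x / L^{Ad} + (4 √(2q) + 1) x^{1−ν}`. -/
theorem disp_terms_le {L κ x M₀r Mb Mb' P' q σ₁ σ₂ θ η δ ν Ad : ℝ} (hL : 1 ≤ L) (hκ0 : 0 < κ)
    (hκ1 : κ ≤ 1) (hx : 1 ≤ x) (hM₀r : 0 < M₀r) (hMb' : M₀r ≤ Mb') (hMb : Mb ≤ Mb')
    (hlen : Mb' - Mb + 1 ≤ 4 * κ * Mb') (hM₀x : x ^ (σ₁ / 2) ≤ 2 * M₀r) (hq : 1 ≤ q)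
    (hTM : Mb' ≤ 2 * q * x ^ (σ₂ + η)) (hP'0 : 0 < P') (hP' : P' ≤ x ^ σ₂)
    (hνσ : ν ≤ σ₁ / 4) (hνδ : ν ≤ δ) (hδ16 : δ ≤ 1 / 16) (hη16 : η ≤ 1 / 16)
    (hσ₂ : σ₂ < 1 / 2) (hexp4 : δ + (1 + θ) / 2 + σ₂ ≤ 1 - ν) (hν0 : 0 < ν) :
    L ^ 4 * (x / Mb') * (Mb' - Mb + 1) ^ (1 / 2 : ℝ) +
      (x / Mb') * (Mb' - Mb + 1) / L ^ Ad +
      x ^ δ * (x / Mb') ^ (1 / 2 : ℝ) * (Mb' - Mb + 1) +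
      x ^ δ * (x ^ (1 + θ) / P') ^ (1 / 2 : ℝ) * P' ^ (3 / 2 : ℝ) ≤
    3 * L ^ 4 * x ^ (1 - ν) + 4 * κ * x / L ^ Ad + (4 * Real.sqrt (2 * q) + 1) * x ^ (1 - ν) := by
  have hx0 : 0 < x := by linarith
  have hMb'0 : 0 < Mb' := lt_of_lt_of_le hM₀r hMb'
  have hlen0 : 0 ≤ Mb' - Mb + 1 := by linarith
  have hL0 : 0 < L := by linarith
  have hLA : 0 < L ^ Ad := Real.rpow_pos_of_pos hL0 Ad |> fun h => by
    -- `L ^ Ad` with natural-looking exponent: here `Ad : ℝ`, so this is `rpow`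
    exact h
  -- useful: `x^{1-ν} ≥ x^{1 - σ₁/4}` etc.
  have hx1ν : x ^ (1 - σ₁ / 4) ≤ x ^ (1 - ν) := Real.rpow_le_rpow_of_exponent_le hx (by linarith)
  have hxν0 : 0 < x ^ (1 - ν) := Real.rpow_pos_of_pos hx0 _
  -- (T1): `L⁴ (x/Mb') (Mb'-Mb+1)^{1/2} ≤ L⁴ · x · 2 (κ/Mb')^{1/2} ≤ 2 L⁴ x / √M₀r ≤ 2√2 L⁴ x^{1-σ₁/4}`
  have hT1 : L ^ 4 * (x / Mb') * (Mb' - Mb + 1) ^ (1 / 2 : ℝ) ≤ 3 * L ^ 4 * x ^ (1 - ν) := by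
    have h1 : (Mb' - Mb + 1) ^ (1 / 2 : ℝ) ≤ (4 * κ * Mb') ^ (1 / 2 : ℝ) :=
      Real.rpow_le_rpow hlen0 hlen (by norm_num)
    have h2 : (4 * κ * Mb') ^ (1 / 2 : ℝ) ≤ (4 * Mb') ^ (1 / 2 : ℝ) := by
      refine Real.rpow_le_rpow (by positivity) ?_ (by norm_num)
      nlinarith
    have h3 : (4 * Mb') ^ (1 / 2 : ℝ) = 2 * Real.sqrt Mb' := by
      rw [rpow_half_eq_sqrt, Real.sqrt_mul (by norm_num), show (4 : ℝ) = 2 ^ 2 by norm_num,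
        Real.sqrt_sq (by norm_num)]
    have h4 : x / Mb' * (2 * Real.sqrt Mb') = 2 * x / Real.sqrt Mb' := by
      have hs : 0 < Real.sqrt Mb' := Real.sqrt_pos.mpr hMb'0
      field_simp
      rw [Real.sq_sqrt hMb'0.le]
    -- `1/√Mb' ≤ 1/√M₀r ≤ √2 · x^{-σ₁/4}`
    have h5 : 2 * x / Real.sqrt Mb' ≤ 2 * x / Real.sqrt M₀r := by
      refine div_le_div_of_nonneg_left (by positivity) (Real.sqrt_pos.mpr hM₀r) (Real.sqrt_le_sqrt hMb')
    have h6 : Real.sqrt (x ^ (σ₁ / 2)) ≤ Real.sqrt (2 * M₀r) := Real.sqrt_le_sqrt hM₀x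
    have h7 : Real.sqrt (x ^ (σ₁ / 2)) = x ^ (σ₁ / 4) := by
      rw [Real.sqrt_eq_rpow, ← Real.rpow_mul hx0.le]; ring_nf
    have h8 : Real.sqrt (2 * M₀r) = Real.sqrt 2 * Real.sqrt M₀r := Real.sqrt_mul (by norm_num) _
    have h9 : x ^ (σ₁ / 4) ≤ Real.sqrt 2 * Real.sqrt M₀r := by rw [← h7, ← h8]; exact h6
    have h10 : 2 * x / Real.sqrt M₀r ≤ 2 * Real.sqrt 2 * x ^ (1 - σ₁ / 4) := by
      rw [div_le_iff₀ (Real.sqrt_pos.mpr hM₀r)]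
      have : x = x ^ (1 - σ₁ / 4) * x ^ (σ₁ / 4) := by
        rw [← Real.rpow_add hx0]; ring_nf; exact (Real.rpow_one x).symm
      have hxp : 0 ≤ x ^ (1 - σ₁ / 4) := by positivity
      calc 2 * x = 2 * x ^ (1 - σ₁ / 4) * x ^ (σ₁ / 4) := by rw [mul_assoc, ← this]
        _ ≤ 2 * x ^ (1 - σ₁ / 4) * (Real.sqrt 2 * Real.sqrt M₀r) := by
            exact mul_le_mul_of_nonneg_left h9 (by positivity)
        _ = 2 * Real.sqrt 2 * x ^ (1 - σ₁ / 4) * Real.sqrt M₀r := by ring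
    have hs2 : Real.sqrt 2 ≤ 3 / 2 := by
      rw [Real.sqrt_le_left (by norm_num)]; norm_num
    have hL4 : 0 ≤ L ^ 4 := by positivity
    calc L ^ 4 * (x / Mb') * (Mb' - Mb + 1) ^ (1 / 2 : ℝ)
        ≤ L ^ 4 * (x / Mb') * (2 * Real.sqrt Mb') := by
          rw [← h3]; exact mul_le_mul_of_nonneg_left (h1.trans h2) (by positivity)
      _ = L ^ 4 * (2 * x / Real.sqrt Mb') := by rw [mul_assoc, h4]
      _ ≤ L ^ 4 * (2 * Real.sqrt 2 * x ^ (1 - σ₁ / 4)) := mul_le_mul_of_nonneg_left (h5.trans h10) hL4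
      _ ≤ L ^ 4 * (3 * x ^ (1 - ν)) := by
          refine mul_le_mul_of_nonneg_left ?_ hL4
          have hxp : 0 ≤ x ^ (1 - σ₁ / 4) := by positivity
          nlinarith
      _ = 3 * L ^ 4 * x ^ (1 - ν) := by ring
  -- (T2): `(x/Mb')(Mb'-Mb+1)/L^Ad ≤ 4κ x / L^Ad`
  have hT2 : (x / Mb') * (Mb' - Mb + 1) / L ^ Ad ≤ 4 * κ * x / L ^ Ad := by
    refine div_le_div_of_nonneg_right ?_ hLA.le
    calc x / Mb' * (Mb' - Mb + 1) ≤ x / Mb' * (4 * κ * Mb') :=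
          mul_le_mul_of_nonneg_left hlen (by positivity)
      _ = 4 * κ * x := by field_simp
  -- (T3): `x^δ (x/Mb')^{1/2} (Mb'-Mb+1) ≤ 4κ x^{δ+1/2} √Mb' ≤ 4 √(2q) x^{δ + 1/2 + (σ₂+η)/2} ≤ 4√(2q) x^{1-ν}`
  have hT3 : x ^ δ * (x / Mb') ^ (1 / 2 : ℝ) * (Mb' - Mb + 1) ≤ 4 * Real.sqrt (2 * q) * x ^ (1 - ν) := by
    have h1 : (x / Mb') ^ (1 / 2 : ℝ) = Real.sqrt x / Real.sqrt Mb' := by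
      rw [rpow_half_eq_sqrt, Real.sqrt_div hx0.le]
    have hsM : 0 < Real.sqrt Mb' := Real.sqrt_pos.mpr hMb'0
    have h2 : x ^ δ * (x / Mb') ^ (1 / 2 : ℝ) * (Mb' - Mb + 1) ≤
        x ^ δ * (Real.sqrt x / Real.sqrt Mb') * (4 * κ * Mb') := by
      rw [h1]; exact mul_le_mul_of_nonneg_left hlen (by positivity)
    have h3 : x ^ δ * (Real.sqrt x / Real.sqrt Mb') * (4 * κ * Mb') = 4 * κ * x ^ δ * Real.sqrt x * Real.sqrt Mb' := by
      field_simp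
      rw [Real.sq_sqrt hMb'0.le]
    have h4 : Real.sqrt Mb' ≤ Real.sqrt (2 * q) * x ^ ((σ₂ + η) / 2) := by
      calc Real.sqrt Mb' ≤ Real.sqrt (2 * q * x ^ (σ₂ + η)) := Real.sqrt_le_sqrt hTM
        _ = Real.sqrt (2 * q) * Real.sqrt (x ^ (σ₂ + η)) := Real.sqrt_mul (by positivity) _
        _ = Real.sqrt (2 * q) * x ^ ((σ₂ + η) / 2) := by
            rw [Real.sqrt_eq_rpow (x ^ (σ₂ + η)), ← Real.rpow_mul hx0.le]; ring_nf
    have h5 : x ^ δ * Real.sqrt x * x ^ ((σ₂ + η) / 2) = x ^ (δ + 1 / 2 + (σ₂ + η) / 2) := by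
      rw [Real.sqrt_eq_rpow, ← Real.rpow_add hx0, ← Real.rpow_add hx0]
    have h6 : x ^ (δ + 1 / 2 + (σ₂ + η) / 2) ≤ x ^ (1 - ν) :=
      Real.rpow_le_rpow_of_exponent_le hx (by linarith)
    calc x ^ δ * (x / Mb') ^ (1 / 2 : ℝ) * (Mb' - Mb + 1)
        ≤ 4 * κ * x ^ δ * Real.sqrt x * Real.sqrt Mb' := h2.trans_eq h3
      _ ≤ 4 * 1 * x ^ δ * Real.sqrt x * (Real.sqrt (2 * q) * x ^ ((σ₂ + η) / 2)) := by
          have ha : 0 ≤ x ^ δ * Real.sqrt x := by positivity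
          have := mul_le_mul (mul_le_mul_of_nonneg_left hκ1 (by norm_num : (0:ℝ) ≤ 4)) h4 hsM.le (by positivity)
          nlinarith [this]
      _ = 4 * Real.sqrt (2 * q) * (x ^ δ * Real.sqrt x * x ^ ((σ₂ + η) / 2)) := by ring
      _ = 4 * Real.sqrt (2 * q) * x ^ (δ + 1 / 2 + (σ₂ + η) / 2) := by rw [h5]
      _ ≤ 4 * Real.sqrt (2 * q) * x ^ (1 - ν) := mul_le_mul_of_nonneg_left h6 (by positivity)
  -- (T4): `x^δ (x^{1+θ}/P')^{1/2} P'^{3/2} = x^{δ + (1+θ)/2} P' ≤ x^{δ + (1+θ)/2 + σ₂} ≤ x^{1-ν}`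
  have hT4 : x ^ δ * (x ^ (1 + θ) / P') ^ (1 / 2 : ℝ) * P' ^ (3 / 2 : ℝ) ≤ x ^ (1 - ν) := by
    have h1 : (x ^ (1 + θ) / P') ^ (1 / 2 : ℝ) * P' ^ (3 / 2 : ℝ) = x ^ ((1 + θ) / 2) * P' := by
      rw [Real.div_rpow (by positivity) hP'0.le, ← Real.rpow_mul hx0.le]
      have : P' ^ (3 / 2 : ℝ) = P' ^ (1 / 2 : ℝ) * P' := by
        rw [show (3 / 2 : ℝ) = 1 / 2 + 1 by norm_num, Real.rpow_add hP'0, Real.rpow_one]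
      rw [this]
      have hP12 : 0 < P' ^ (1 / 2 : ℝ) := Real.rpow_pos_of_pos hP'0 _
      field_simp
    rw [mul_assoc, h1]
    calc x ^ δ * (x ^ ((1 + θ) / 2) * P') ≤ x ^ δ * (x ^ ((1 + θ) / 2) * x ^ σ₂) := by
          exact mul_le_mul_of_nonneg_left (mul_le_mul_of_nonneg_left hP' (by positivity)) (by positivity)
      _ = x ^ (δ + (1 + θ) / 2 + σ₂) := by
          rw [← Real.rpow_add hx0, ← Real.rpow_add hx0]; ring_nf
      _ ≤ x ^ (1 - ν) := Real.rpow_le_rpow_of_exponent_le hx hexp4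
  have : (4 * Real.sqrt (2 * q) + 1) * x ^ (1 - ν) = 4 * Real.sqrt (2 * q) * x ^ (1 - ν) + x ^ (1 - ν) := by ring
  rw [this]
  linarith


/-- **Grid package.** With `κ L^kκ = 1`, `L ≥ 1`, `1 ≤ BP ≤ TP`, `1 ≤ M₀ ≤ TM`, `log TP ≤ L`,
`log TM ≤ 2L`, `6L^kκ − 1 ≤ BP`, `3L^kκ + 15 ≤ M₀`: the geometric grids `bP` (from `BP` to `TP`) and `bM`
(from `M₀` to `TM`) of ratio `1+κ`, with `≤ 5 L^{kκ+1}` steps each and the ratio facts used downstream. -/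
theorem grid_facts {L κ : ℝ} {kκ BP TP M₀ TM : ℕ} (hL1 : 1 ≤ L) (hκ0 : 0 < κ) (hκ1 : κ ≤ 1)
    (hκL : κ * L ^ kκ = 1) (hLk1 : 1 ≤ L ^ kκ) (hBP1 : 1 ≤ BP) (hBPTP : BP ≤ TP) (hM₀1 : 1 ≤ M₀)
    (hM₀TM : M₀ ≤ TM) (hlogTP : Real.log TP ≤ L) (hlogTM : Real.log TM ≤ 2 * L)
    (hBPlow : 6 * L ^ kκ - 1 ≤ (BP : ℝ)) (hM₀low : 3 * L ^ kκ + 15 ≤ (M₀ : ℝ)) :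
    ∃ (SP SM : ℕ) (bP bM : ℕ → ℕ), Monotone bP ∧ Monotone bM ∧ bP 0 = BP ∧ bP SP = TP ∧ bM 0 = M₀ ∧
      bM SM = TM ∧ (SP : ℝ) ≤ 5 * L ^ (kκ + 1) ∧ (SM : ℝ) ≤ 5 * L ^ (kκ + 1) ∧
      (∀ s, (BP : ℝ) ≤ bP s) ∧ (∀ j, (M₀ : ℝ) ≤ bM j) ∧
      (∀ s, ((bP (s + 1) : ℕ) : ℝ) ≤ (1 + κ) * bP s + 2) ∧ (∀ j, ((bM (j + 1) : ℕ) : ℝ) ≤ (1 + κ) * bM j + 2) ∧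
      (∀ s, ((bP (s + 1) : ℕ) : ℝ) ≤ (1 + 2 * κ) * bP s) ∧
      (∀ j, ((bM (j + 1) : ℕ) : ℝ) ≤ (1 + 2 * κ) * ((bM j : ℝ) + 1)) ∧ 2 ≤ κ * BP ∧ 3 ≤ κ * M₀ := by
  set SP : ℕ := ⌈Real.log ((TP : ℝ) / BP) / Real.log (1 + κ)⌉₊ with hSPdef
  set SM : ℕ := ⌈Real.log ((TM : ℝ) / M₀) / Real.log (1 + κ)⌉₊ with hSMdef
  set bP : ℕ → ℕ := fun s => min TP ⌊(BP : ℝ) * (1 + κ) ^ s⌋₊ with hbP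
  set bM : ℕ → ℕ := fun j => min TM ⌊(M₀ : ℝ) * (1 + κ) ^ j⌋₊ with hbM
  have hbPmono : Monotone bP := by rw [hbP]; exact GeometricGrid.grid_monotone BP TP hκ0.le
  have hbMmono : Monotone bM := by rw [hbM]; exact GeometricGrid.grid_monotone M₀ TM hκ0.le
  have hbP0 : bP 0 = BP := GeometricGrid.grid_zero hBPTP κ
  have hbM0 : bM 0 = M₀ := GeometricGrid.grid_zero hM₀TM κ
  have hbPS : bP SP = TP := GeometricGrid.grid_top (GeometricGrid.le_grid_pow hBP1 hBPTP hκ0)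
  have hbMS : bM SM = TM := GeometricGrid.grid_top (GeometricGrid.le_grid_pow hM₀1 hM₀TM hκ0)
  have hinv : κ = (L ^ kκ)⁻¹ := by
    have hne : L ^ kκ ≠ 0 := by positivity
    field_simp; linarith only [hκL]
  have hstep : ∀ {B T : ℕ}, 1 ≤ B → B ≤ T → Real.log T ≤ 2 * L →
      (⌈Real.log ((T : ℝ) / B) / Real.log (1 + κ)⌉₊ : ℝ) ≤ 5 * L ^ (kκ + 1) := by
    intro B T hB hBT hlog
    have h1 := GeometricGrid.ceil_log_div_le hB hBT hκ0 hκ1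
    have h3 : 2 * Real.log T / κ ≤ 4 * L * L ^ kκ := by
      rw [hinv, div_inv_eq_mul]
      exact mul_le_mul_of_nonneg_right (by linarith only [hlog]) (by positivity)
    calc (⌈Real.log ((T : ℝ) / B) / Real.log (1 + κ)⌉₊ : ℝ) ≤ 2 * Real.log T / κ + 1 := h1
      _ ≤ 4 * L * L ^ kκ + 1 := by linarith only [h3]
      _ ≤ 5 * L ^ (kκ + 1) := by
          rw [show L ^ (kκ + 1) = L ^ kκ * L from pow_succ L kκ]
          have hp := one_le_mul_of_one_le_of_one_le hLk1 hL1; linarith only [hp]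
  have hSPle : (SP : ℝ) ≤ 5 * L ^ (kκ + 1) := hstep hBP1 hBPTP (by linarith only [hlogTP, hL1])
  have hSMle : (SM : ℝ) ≤ 5 * L ^ (kκ + 1) := hstep hM₀1 hM₀TM hlogTM
  have hbPge : ∀ s, (BP : ℝ) ≤ bP s := fun s => by
    have : bP 0 ≤ bP s := hbPmono (Nat.zero_le s)
    rw [hbP0] at this; exact_mod_cast this
  have hbMge : ∀ j, (M₀ : ℝ) ≤ bM j := fun j => by
    have : bM 0 ≤ bM j := hbMmono (Nat.zero_le j)
    rw [hbM0] at this; exact_mod_cast this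
  have hκBP : 2 ≤ κ * BP := by
    have h2 : κ * (6 * L ^ kκ - 1) ≤ κ * BP := mul_le_mul_of_nonneg_left hBPlow hκ0.le
    have h3 : κ * (6 * L ^ kκ - 1) = 6 - κ := by linear_combination 6 * hκL
    linarith only [h2, h3, hκ1]
  have hκM₀ : 3 ≤ κ * M₀ := by
    have h2 : κ * (3 * L ^ kκ + 15) ≤ κ * M₀ := mul_le_mul_of_nonneg_left hM₀low hκ0.le
    have h3 : κ * (3 * L ^ kκ + 15) = 3 + 15 * κ := by linear_combination 3 * hκL
    linarith only [h2, h3, hκ0]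
  have hsuccP : ∀ s, ((bP (s + 1) : ℕ) : ℝ) ≤ (1 + κ) * bP s + 2 := fun s =>
    GeometricGrid.grid_succ_le hκ0.le hκ1 s
  have hsuccM : ∀ j, ((bM (j + 1) : ℕ) : ℝ) ≤ (1 + κ) * bM j + 2 := fun j =>
    GeometricGrid.grid_succ_le hκ0.le hκ1 j
  have hratP : ∀ s, ((bP (s + 1) : ℕ) : ℝ) ≤ (1 + 2 * κ) * bP s := fun s => by
    have h1 := hsuccP s
    have h2 : 2 ≤ κ * bP s := hκBP.trans (mul_le_mul_of_nonneg_left (hbPge s) hκ0.le)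
    linarith only [h1, h2]
  have hratM : ∀ j, ((bM (j + 1) : ℕ) : ℝ) ≤ (1 + 2 * κ) * ((bM j : ℝ) + 1) := fun j => by
    have h1 := hsuccM j
    have h2 : 3 ≤ κ * bM j := hκM₀.trans (mul_le_mul_of_nonneg_left (hbMge j) hκ0.le)
    linarith only [h1, h2, hκ0]
  exact ⟨SP, SM, bP, bM, hbPmono, hbMmono, hbP0, hbPS, hbM0, hbMS, hSPle, hSMle, hbPge, hbMge, hsuccP, hsuccM,
    hratP, hratM, hκBP, hκM₀⟩

/-- **Per-box bound.**  For one box `(P,P'] × (Mb,Mb']` of the fine grid: the TRUE box sum is bounded by the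
shell configurations (`stub_pair_middle_box_reduction2`) plus `K ×` the uniform dispersion bound `Dunif`
(`disp_terms_le`), given the dispersion estimate `hBD` for the BOX-form sum (an instance of the aux stub
`stub_pair_middle_boxdisp`). -/
theorem perbox_bound {q₀ a₀ q₁ a₁ : ℤ} (hq₀ : 0 < q₀) (hq₁ : 0 < q₁)
    {σ₁ σ₂ θ η δ ν K Ad κ : ℝ} {x Xb P P' Mb Mb' M₀ : ℕ}
    (hK : 0 < K) (hL1 : 1 ≤ 1 + Real.log x) (hκ0 : 0 < κ) (hκ1 : κ ≤ 1) (hx1R : (1 : ℝ) ≤ x)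
    (hq₁R : (1 : ℝ) ≤ q₁) (hPpos : 0 < P) (hP : P < P') (hP'Xb : P' ≤ Xb) (hMj : Mb < Mb')
    (hL₀P : ((q₁.toNat + a₁.natAbs + q₁.toNat * (a₀.natAbs + 1) + 2 : ℕ) : ℝ) ≤ (x : ℝ) ^ (1 - η) / P)
    (hBD : |∑ d₀ ∈ Finset.Ioc P P', ∑ d₁ ∈ Finset.Icc 1 Xb, ∑ m ∈ Finset.Ioc Mb Mb',
          (if ((d₁ : ℤ) * m - a₁) % q₁ = 0 ∧
              (q₁ * (d₀ : ℤ) ∣ q₀ * ((d₁ : ℤ) * m) + (q₁ * a₀ - q₀ * a₁)) ∧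
              ((x : ℝ) ^ (1 - η) / P < (d₁ : ℝ) ∧ (d₁ : ℝ) ≤ (x : ℝ) ^ (1 + θ) / P' ∧
                (d₁ : ℝ) ≤ ((q₁ : ℝ) * x + a₁) / Mb') ∧
              ((x : ℝ) ^ σ₁ < (d₀ : ℝ) ∧ (d₀ : ℝ) ≤ (x : ℝ) ^ σ₂) then
            ((ArithmeticFunction.moebius d₀ : ℝ) * Real.log d₀) *
              ((ArithmeticFunction.moebius d₁ : ℝ) * Real.log d₁) else 0)| ≤
        K * ((1 + Real.log x) ^ 4 * ((x : ℝ) / Mb') * ((Mb' : ℝ) - Mb + 1) ^ (1 / 2 : ℝ) +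
             ((x : ℝ) / Mb') * ((Mb' : ℝ) - Mb + 1) / (1 + Real.log x) ^ Ad +
             (x : ℝ) ^ δ * ((x : ℝ) / Mb') ^ (1 / 2 : ℝ) * ((Mb' : ℝ) - Mb + 1) +
             (x : ℝ) ^ δ * ((x : ℝ) ^ (1 + θ) / P') ^ (1 / 2 : ℝ) * (P' : ℝ) ^ (3 / 2 : ℝ)))
    (hM₀pos : (0 : ℝ) < M₀) (hMb'M₀ : (M₀ : ℝ) ≤ Mb') (hlen : (Mb' : ℝ) - Mb + 1 ≤ 4 * κ * Mb')
    (hM₀x : (x : ℝ) ^ (σ₁ / 2) ≤ 2 * (M₀ : ℝ)) (hMb'TMr : (Mb' : ℝ) ≤ 2 * q₁ * (x : ℝ) ^ (σ₂ + η))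
    (hP'R : (P' : ℝ) ≤ (x : ℝ) ^ σ₂) (hνσ : ν ≤ σ₁ / 4) (hνδ : ν ≤ δ) (hδ16 : δ ≤ 1 / 16)
    (hη16 : η ≤ 1 / 16) (hσ₂ : σ₂ < 1 / 2) (hexp4 : δ + (1 + θ) / 2 + σ₂ ≤ 1 - ν) (hν0 : 0 < ν) :
    |∑ d₀ ∈ Finset.Ioc P P', ∑ d₁ ∈ Finset.Icc 1 Xb, ∑ m ∈ Finset.Ioc Mb Mb',
        (if ((d₁ : ℤ) * m - a₁) % q₁ = 0 ∧
            (1 ≤ ((d₁ : ℤ) * m - a₁) / q₁ ∧ ((d₁ : ℤ) * m - a₁) / q₁ ≤ x) ∧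
            (1 ≤ q₀ * (((d₁ : ℤ) * m - a₁) / q₁) + a₀ ∧ (d₀ : ℤ) ∣ q₀ * (((d₁ : ℤ) * m - a₁) / q₁) + a₀) ∧
            ((x : ℝ) ^ (1 - η) < (d₀ : ℝ) * d₁ ∧ (d₀ : ℝ) * d₁ ≤ (x : ℝ) ^ (1 + θ) ∧
              ((x : ℝ) ^ σ₁ < (d₀ : ℝ) ∧ (d₀ : ℝ) ≤ (x : ℝ) ^ σ₂)) then
          ((ArithmeticFunction.moebius d₀ : ℝ) * Real.log d₀) *
            ((ArithmeticFunction.moebius d₁ : ℝ) * Real.log d₁) else 0)| ≤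
    (1 + Real.log Xb) ^ 2 *
      ((((Finset.Ioc P P' ×ˢ Finset.Icc 1 Xb) ×ˢ Finset.Ioc Mb Mb').filter (fun c : (ℕ × ℕ) × ℕ =>
        (((c.1.2 : ℤ) * c.2 - a₁) % q₁ = 0 ∧
          (1 ≤ ((c.1.2 : ℤ) * c.2 - a₁) / q₁ ∧ ((c.1.2 : ℤ) * c.2 - a₁) / q₁ ≤ x) ∧
          (1 ≤ q₀ * (((c.1.2 : ℤ) * c.2 - a₁) / q₁) + a₀ ∧
            (c.1.1 : ℤ) ∣ q₀ * (((c.1.2 : ℤ) * c.2 - a₁) / q₁) + a₀)) ∧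
        (((x : ℝ) ^ (1 - η) < (c.1.1 : ℝ) * c.1.2 ∧ (c.1.1 : ℝ) * c.1.2 ≤ (x : ℝ) ^ (1 - η) * P' / P) ∨
         ((x : ℝ) ^ (1 + θ) * P / P' < (c.1.1 : ℝ) * c.1.2 ∧ (c.1.1 : ℝ) * c.1.2 ≤ (x : ℝ) ^ (1 + θ)) ∨
         (((q₁ : ℝ) * x + a₁) * (Mb + 1) / Mb' < (c.1.2 : ℝ) * c.2)))).card : ℝ) +
    K * (3 * (1 + Real.log x) ^ 4 * (x : ℝ) ^ (1 - ν) + 4 * κ * x / (1 + Real.log x) ^ Ad +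
      (4 * Real.sqrt (2 * q₁) + 1) * (x : ℝ) ^ (1 - ν)) := by
  have hBX := stub_pair_middle_box_reduction2 q₀ a₀ q₁ a₁ σ₁ σ₂ θ η x Xb P P' Mb Mb' hq₀ hq₁ hPpos hP hP'Xb hMj hL₀P
  have hMbR : (Mb : ℝ) ≤ Mb' := by exact_mod_cast hMj.le
  have hP'pos : (0 : ℝ) < P' := by exact_mod_cast hPpos.trans hP
  have hT := disp_terms_le (Ad := Ad) hL1 hκ0 hκ1 hx1R hM₀pos hMb'M₀ hMbR hlen hM₀x hq₁R hMb'TMr hP'pos hP'R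
    hνσ hνδ hδ16 hη16 hσ₂ hexp4 hν0
  have hKT := mul_le_mul_of_nonneg_left hT hK.le
  have habs := abs_sub_abs_le_abs_sub
    (∑ d₀ ∈ Finset.Ioc P P', ∑ d₁ ∈ Finset.Icc 1 Xb, ∑ m ∈ Finset.Ioc Mb Mb',
        (if ((d₁ : ℤ) * m - a₁) % q₁ = 0 ∧
            (1 ≤ ((d₁ : ℤ) * m - a₁) / q₁ ∧ ((d₁ : ℤ) * m - a₁) / q₁ ≤ x) ∧
            (1 ≤ q₀ * (((d₁ : ℤ) * m - a₁) / q₁) + a₀ ∧ (d₀ : ℤ) ∣ q₀ * (((d₁ : ℤ) * m - a₁) / q₁) + a₀) ∧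
            ((x : ℝ) ^ (1 - η) < (d₀ : ℝ) * d₁ ∧ (d₀ : ℝ) * d₁ ≤ (x : ℝ) ^ (1 + θ) ∧
              ((x : ℝ) ^ σ₁ < (d₀ : ℝ) ∧ (d₀ : ℝ) ≤ (x : ℝ) ^ σ₂)) then
          ((ArithmeticFunction.moebius d₀ : ℝ) * Real.log d₀) *
            ((ArithmeticFunction.moebius d₁ : ℝ) * Real.log d₁) else 0))
    (∑ d₀ ∈ Finset.Ioc P P', ∑ d₁ ∈ Finset.Icc 1 Xb, ∑ m ∈ Finset.Ioc Mb Mb',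
        (if ((d₁ : ℤ) * m - a₁) % q₁ = 0 ∧
            (q₁ * (d₀ : ℤ) ∣ q₀ * ((d₁ : ℤ) * m) + (q₁ * a₀ - q₀ * a₁)) ∧
            ((x : ℝ) ^ (1 - η) / P < (d₁ : ℝ) ∧ (d₁ : ℝ) ≤ (x : ℝ) ^ (1 + θ) / P' ∧
              (d₁ : ℝ) ≤ ((q₁ : ℝ) * x + a₁) / Mb') ∧
            ((x : ℝ) ^ σ₁ < (d₀ : ℝ) ∧ (d₀ : ℝ) ≤ (x : ℝ) ^ σ₂) then
          ((ArithmeticFunction.moebius d₀ : ℝ) * Real.log d₀) *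
            ((ArithmeticFunction.moebius d₁ : ℝ) * Real.log d₁) else 0))
  linarith only [hBX, hBD, hKT, habs]

end MiddleAssembly

/-- **Auxiliary stub `stub_pair_middle_perbox`** (head of this helper file; parent stub `stub_pair_middle`):
the per-box bound `MiddleAssembly.perbox_bound` in closed form. -/
theorem stub_pair_middle_perbox : ∀ (q₀ a₀ q₁ a₁ : ℤ), 0 < q₀ → 0 < q₁ →
    ∀ (σ₁ σ₂ θ η δ ν K Ad κ : ℝ) (x Xb P P' Mb Mb' M₀ : ℕ),
    0 < K → 1 ≤ 1 + Real.log x → 0 < κ → κ ≤ 1 → (1 : ℝ) ≤ x → (1 : ℝ) ≤ q₁ → 0 < P → P < P' → P' ≤ Xb →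
    Mb < Mb' →
    ((q₁.toNat + a₁.natAbs + q₁.toNat * (a₀.natAbs + 1) + 2 : ℕ) : ℝ) ≤ (x : ℝ) ^ (1 - η) / P →
    |∑ d₀ ∈ Finset.Ioc P P', ∑ d₁ ∈ Finset.Icc 1 Xb, ∑ m ∈ Finset.Ioc Mb Mb',
          (if ((d₁ : ℤ) * m - a₁) % q₁ = 0 ∧
              (q₁ * (d₀ : ℤ) ∣ q₀ * ((d₁ : ℤ) * m) + (q₁ * a₀ - q₀ * a₁)) ∧
              ((x : ℝ) ^ (1 - η) / P < (d₁ : ℝ) ∧ (d₁ : ℝ) ≤ (x : ℝ) ^ (1 + θ) / P' ∧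
                (d₁ : ℝ) ≤ ((q₁ : ℝ) * x + a₁) / Mb') ∧
              ((x : ℝ) ^ σ₁ < (d₀ : ℝ) ∧ (d₀ : ℝ) ≤ (x : ℝ) ^ σ₂) then
            ((ArithmeticFunction.moebius d₀ : ℝ) * Real.log d₀) *
              ((ArithmeticFunction.moebius d₁ : ℝ) * Real.log d₁) else 0)| ≤
        K * ((1 + Real.log x) ^ 4 * ((x : ℝ) / Mb') * ((Mb' : ℝ) - Mb + 1) ^ (1 / 2 : ℝ) +
             ((x : ℝ) / Mb') * ((Mb' : ℝ) - Mb + 1) / (1 + Real.log x) ^ Ad +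
             (x : ℝ) ^ δ * ((x : ℝ) / Mb') ^ (1 / 2 : ℝ) * ((Mb' : ℝ) - Mb + 1) +
             (x : ℝ) ^ δ * ((x : ℝ) ^ (1 + θ) / P') ^ (1 / 2 : ℝ) * (P' : ℝ) ^ (3 / 2 : ℝ)) →
    (0 : ℝ) < M₀ → (M₀ : ℝ) ≤ Mb' → (Mb' : ℝ) - Mb + 1 ≤ 4 * κ * Mb' → (x : ℝ) ^ (σ₁ / 2) ≤ 2 * (M₀ : ℝ) →
    (Mb' : ℝ) ≤ 2 * q₁ * (x : ℝ) ^ (σ₂ + η) → (P' : ℝ) ≤ (x : ℝ) ^ σ₂ → ν ≤ σ₁ / 4 → ν ≤ δ → δ ≤ 1 / 16 →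
    η ≤ 1 / 16 → σ₂ < 1 / 2 → δ + (1 + θ) / 2 + σ₂ ≤ 1 - ν → 0 < ν →
    |∑ d₀ ∈ Finset.Ioc P P', ∑ d₁ ∈ Finset.Icc 1 Xb, ∑ m ∈ Finset.Ioc Mb Mb',
        (if ((d₁ : ℤ) * m - a₁) % q₁ = 0 ∧
            (1 ≤ ((d₁ : ℤ) * m - a₁) / q₁ ∧ ((d₁ : ℤ) * m - a₁) / q₁ ≤ x) ∧
            (1 ≤ q₀ * (((d₁ : ℤ) * m - a₁) / q₁) + a₀ ∧ (d₀ : ℤ) ∣ q₀ * (((d₁ : ℤ) * m - a₁) / q₁) + a₀) ∧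
            ((x : ℝ) ^ (1 - η) < (d₀ : ℝ) * d₁ ∧ (d₀ : ℝ) * d₁ ≤ (x : ℝ) ^ (1 + θ) ∧
              ((x : ℝ) ^ σ₁ < (d₀ : ℝ) ∧ (d₀ : ℝ) ≤ (x : ℝ) ^ σ₂)) then
          ((ArithmeticFunction.moebius d₀ : ℝ) * Real.log d₀) *
            ((ArithmeticFunction.moebius d₁ : ℝ) * Real.log d₁) else 0)| ≤
    (1 + Real.log Xb) ^ 2 *
      ((((Finset.Ioc P P' ×ˢ Finset.Icc 1 Xb) ×ˢ Finset.Ioc Mb Mb').filter (fun c : (ℕ × ℕ) × ℕ =>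
        (((c.1.2 : ℤ) * c.2 - a₁) % q₁ = 0 ∧
          (1 ≤ ((c.1.2 : ℤ) * c.2 - a₁) / q₁ ∧ ((c.1.2 : ℤ) * c.2 - a₁) / q₁ ≤ x) ∧
          (1 ≤ q₀ * (((c.1.2 : ℤ) * c.2 - a₁) / q₁) + a₀ ∧
            (c.1.1 : ℤ) ∣ q₀ * (((c.1.2 : ℤ) * c.2 - a₁) / q₁) + a₀)) ∧
        (((x : ℝ) ^ (1 - η) < (c.1.1 : ℝ) * c.1.2 ∧ (c.1.1 : ℝ) * c.1.2 ≤ (x : ℝ) ^ (1 - η) * P' / P) ∨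
         ((x : ℝ) ^ (1 + θ) * P / P' < (c.1.1 : ℝ) * c.1.2 ∧ (c.1.1 : ℝ) * c.1.2 ≤ (x : ℝ) ^ (1 + θ)) ∨
         (((q₁ : ℝ) * x + a₁) * (Mb + 1) / Mb' < (c.1.2 : ℝ) * c.2)))).card : ℝ) +
    K * (3 * (1 + Real.log x) ^ 4 * (x : ℝ) ^ (1 - ν) + 4 * κ * x / (1 + Real.log x) ^ Ad +
      (4 * Real.sqrt (2 * q₁) + 1) * (x : ℝ) ^ (1 - ν)) :=
  fun _ _ _ _ hq₀ hq₁ _ _ _ _ _ _ _ _ _ _ _ _ _ _ _ _ hK hL1 hκ0 hκ1 hx1R hq₁R hPpos hP hP'Xb hMj hL₀P hBD hM₀pos hMb'M₀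
      hlen hM₀x hMb'TMr hP'R hνσ hνδ hδ16 hη16 hσ₂ hexp4 hν0 =>
    MiddleAssembly.perbox_bound hq₀ hq₁ hK hL1 hκ0 hκ1 hx1R hq₁R hPpos hP hP'Xb hMj hL₀P hBD hM₀pos hMb'M₀ hlen hM₀x
      hMb'TMr hP'R hνσ hνδ hδ16 hη16 hσ₂ hexp4 hν0

end Summit.Parity.BatemanHorn.Theorems.PolyMobiusTail.EtaFreeWindow
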